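import Summits.CriticalPhenomena.Ising3DConformalLimit.Theorems.HarmonicMomentsIsotropyDilutionTransferNuB1
import Summits.CriticalPhenomena.Ising3DConformalLimit.Theorems.HarmonicMomentsIsotropyDilutionTransferLatticeSumsA

/-!
# The window transfer: critical lattice sums versus `χ(β) ∫ ψ dν_β`, and the scale matching

Support file for item `DilutionTransfer` (stmt-CriticalPhenomena-6037) of route
`HarmonicMomentsIsotropy` (sub-problem `Ising3DConformalLimit`).

* `exists_support_bound`, `exists_pos_cube` — support radius and a positivity cube of a test function;
* `sum_sq_mulVec_eq`, `sum_sq_le_three_mul_norm_sq` — orthogonal matrices preserve `∑ vᵢ²`;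
* `transfer_bounds` — **inside the critical window, `(1-ε)∑ₓψ(x/ξ₂)G_{β_c}(x) ≤ χ∫ψ dν_β ≤ ∑ₓψ(x/ξ₂)G_{β_c}(x)`**;
* `continuousAt_xi`, `exists_beta_matching_scale` — `ξ₂` is continuous on `(0,β_c)` and, with
  `ξ₂ → ∞`, takes every large value `κL` on `(b, β_c)` (IVT).
-/

noncomputable section

open MeasureTheory Filter Topology Set
open scoped ENNReal NNReal BigOperators
open Literature.Probability.LatticeModels

namespace Summit.CriticalPhenomena.Ising3DConformalLimit.Theorems.HarmonicMomentsIsotropy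

/-! ## Test functions: support, positivity cube -/

/-- A compactly supported function vanishes outside a sup-norm ball. -/
theorem exists_support_bound {φ : (Fin 3 → ℝ) → ℝ} (hφs : HasCompactSupport φ) :
    ∃ B : ℝ, 0 < B ∧ ∀ v, φ v ≠ 0 → ‖v‖ < B := by
  obtain ⟨R, hR⟩ := (hφs.isCompact.isBounded).subset_closedBall 0
  refine ⟨max R 0 + 1, by positivity, fun v hv => ?_⟩
  have hv' : v ∈ tsupport φ := subset_tsupport _ (Function.mem_support.2 hv)
  have := hR hv'
  rw [Metric.mem_closedBall, dist_zero_right] at this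
  linarith [le_max_left R 0]

/-- A nonnegative continuous function which is positive somewhere is bounded below by a positive
constant on a small cube centred at a NONZERO point, well inside the punctured space. -/
theorem exists_pos_cube {φ : (Fin 3 → ℝ) → ℝ} (hφc : Continuous φ) (hpos : ∃ v, 0 < φ v) :
    ∃ (v₁ : Fin 3 → ℝ) (r₁ m : ℝ), v₁ ≠ 0 ∧ 0 < r₁ ∧ r₁ ≤ ‖v₁‖ / 4 ∧ 0 < m ∧
      ∀ v ∈ Metric.closedBall v₁ r₁, m ≤ φ v := by
  obtain ⟨v, hv⟩ := hpos
  -- a ball around `v` where `φ > φ v / 2`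
  have hct := Metric.continuousAt_iff.1 (hφc.continuousAt (x := v)) (φ v / 2) (half_pos hv)
  obtain ⟨r₀, hr₀, hball⟩ := hct
  have hball' : ∀ u, dist u v < r₀ → φ v / 2 ≤ φ u := fun u hu => by
    have := hball hu; rw [Real.dist_eq] at this; linarith [(abs_lt.1 this).1]
  -- a nonzero point `v₁` in that ball
  obtain ⟨v₁, hv₁0, hv₁⟩ : ∃ v₁ : Fin 3 → ℝ, v₁ ≠ 0 ∧ dist v₁ v < r₀ / 2 := by
    by_cases h0 : v = 0
    · refine ⟨fun _ => r₀ / 4, fun h => ?_, ?_⟩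
      · have := congrFun h 0; simp at this; linarith
      · rw [h0, dist_zero_right, show (fun _ : Fin 3 => r₀ / 4) = (r₀ / 4) • (1 : Fin 3 → ℝ) by
          funext i; simp, norm_smul, Real.norm_eq_abs, abs_of_pos (by positivity)]
        have : ‖(1 : Fin 3 → ℝ)‖ = 1 := by simp
        rw [this]; linarith
    · exact ⟨v, h0, by rw [dist_self]; positivity⟩
  -- the cube
  set r₁ : ℝ := min (r₀ / 2) (‖v₁‖ / 4) with hr₁
  have hv₁n : 0 < ‖v₁‖ := norm_pos_iff.2 hv₁0
  refine ⟨v₁, r₁, φ v / 2, hv₁0, by positivity, min_le_right _ _, half_pos hv, fun u hu => ?_⟩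
  refine hball' u ?_
  rw [Metric.mem_closedBall] at hu
  calc dist u v ≤ dist u v₁ + dist v₁ v := dist_triangle _ _ _
    _ < r₀ / 2 + r₀ / 2 := add_lt_add_of_le_of_lt (hu.trans (min_le_left _ _)) hv₁
    _ = r₀ := by ring

/-! ## Orthogonal matrices preserve the Euclidean radius; Euclidean versus sup norm -/

/-- `∑ᵢ (Rv)ᵢ² = ∑ᵢ vᵢ²` for `R ∈ O(3)`. -/
theorem sum_sq_mulVec_eq (R : Matrix.orthogonalGroup (Fin 3) ℝ) (v : Fin 3 → ℝ) :
    (∑ i, (R.1.mulVec v i) ^ 2) = ∑ i, (v i) ^ 2 := by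
  have hR : Matrix.transpose R.1 * R.1 = 1 := (Matrix.mem_orthogonalGroup_iff' (Fin 3) ℝ).1 R.2
  have h1 : (∑ i, (R.1.mulVec v i) ^ 2) = dotProduct (R.1.mulVec v) (R.1.mulVec v) := by
    simp [dotProduct, sq]
  have h2 : (∑ i, (v i) ^ 2) = dotProduct v v := by simp [dotProduct, sq]
  rw [h1, h2, Matrix.dotProduct_mulVec, ← Matrix.vecMul_transpose, Matrix.vecMul_vecMul, hR,
    Matrix.vecMul_one]

/-- `∑ᵢ vᵢ² ≤ 3 ‖v‖_∞²`. -/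
theorem sum_sq_le_three_mul_norm_sq (v : Fin 3 → ℝ) : (∑ i, (v i) ^ 2) ≤ 3 * ‖v‖ ^ 2 := by
  have hi : ∀ i : Fin 3, (v i) ^ 2 ≤ ‖v‖ ^ 2 := fun i => by
    have h := norm_le_pi_norm v i
    rw [Real.norm_eq_abs] at h
    calc (v i) ^ 2 = |v i| ^ 2 := (sq_abs _).symm
      _ ≤ ‖v‖ ^ 2 := pow_le_pow_left₀ (abs_nonneg _) h 2
  calc (∑ i, (v i) ^ 2) ≤ ∑ _i : Fin 3, ‖v‖ ^ 2 := Finset.sum_le_sum fun i _ => hi i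
    _ = 3 * ‖v‖ ^ 2 := by simp

/-! ## The window transfer: lattice sums at `β_c` versus `χ(β) ∫ ψ dν_β` -/

/-- **Transfer bounds.** For `0 ≤ β < β_c` and a nonnegative measurable test function `ψ` on `ℝ³`
vanishing outside a ball and whose support (read at scale `ξ₂(β)`) lies in the window where
`(1-ε) G_{β_c} ≤ G_β`:
`(1-ε) ∑ₓ ψ(x/ξ₂) G_{β_c}(x) ≤ χ(β) ∫ ψ dν_β ≤ ∑ₓ ψ(x/ξ₂) G_{β_c}(x)`, and the sum is finite. -/
theorem transfer_bounds {β : ℝ} (hβ : 0 ≤ β) (hβc : β < criticalBeta 3) (hξ : 0 < xi β) {ε : ℝ}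
    (ψ : (Fin 3 → ℝ) → ℝ) (hψ0 : ∀ v, 0 ≤ ψ v) (hψm : Measurable ψ) {Bψ Bs : ℝ}
    (hψb : ∀ v, |ψ v| ≤ Bψ) (hψs : ∀ v, ψ v ≠ 0 → ‖v‖ < Bs)
    (hwin : ∀ x : Site 3, ψ ((xi β)⁻¹ • siteW x) ≠ 0 →
      (1 - ε) * criticalTwoPoint 3 x ≤ twoPointFree 3 β x) :
    Summable (fun x : Site 3 => ψ ((xi β)⁻¹ • siteW x) * criticalTwoPoint 3 x) ∧
    (1 - ε) * (∑' x : Site 3, ψ ((xi β)⁻¹ • siteW x) * criticalTwoPoint 3 x) ≤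
      chi β * ∫ y, ψ (WithLp.ofLp y) ∂(nu β) ∧
    chi β * ∫ y, ψ (WithLp.ofLp y) ∂(nu β) ≤
      ∑' x : Site 3, ψ ((xi β)⁻¹ • siteW x) * criticalTwoPoint 3 x := by
  have hχ := chi_pos hβ hβc
  -- finiteness of the critical sum (finite support)
  have hfin : (Function.support fun x : Site 3 =>
      ψ ((xi β)⁻¹ • siteW x) * criticalTwoPoint 3 x).Finite := by
    refine (LatticeSums.finite_smul_mem_closedBall (inv_pos.2 hξ) 0 Bs).subset fun x hx => ?_
    rw [Function.mem_support] at hx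
    have h1 : ψ ((xi β)⁻¹ • siteW x) ≠ 0 := fun h => hx (by rw [h, zero_mul])
    have h2 := hψs _ h1
    simp only [mem_setOf_eq, Metric.mem_closedBall, dist_zero_right]
    exact le_of_lt h2
  have hsumc : Summable fun x : Site 3 => ψ ((xi β)⁻¹ • siteW x) * criticalTwoPoint 3 x :=
    summable_of_hasFiniteSupport hfin
  -- the integral as a lattice sum
  have hmeas : Measurable fun y : V => ψ (WithLp.ofLp y) :=
    hψm.comp (PiLp.continuous_ofLp 2 _).measurable
  have hbd : ∀ y : V, |ψ (WithLp.ofLp y)| ≤ 0 * ‖y‖ ^ 0 + Bψ := fun y => by simpa using hψb _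
  have hint : chi β * ∫ y, ψ (WithLp.ofLp y) ∂(nu β) =
      ∑' x : Site 3, ψ ((xi β)⁻¹ • siteW x) * twoPointFree 3 β x := by
    rw [integral_nu hβ hβc hmeas hbd, ← mul_assoc, mul_inv_cancel₀ hχ.ne', one_mul]
    refine tsum_congr fun x => ?_
    rw [WithLp.ofLp_smul, mul_comm]
    rfl
  have hsumβ : Summable fun x : Site 3 => ψ ((xi β)⁻¹ • siteW x) * twoPointFree 3 β x := by
    refine IsingInputs.summable_weight_mul_G' hβ hβc (A := 0) (B := Bψ) (q := 0) fun x => ?_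
    simpa using hψb _
  refine ⟨hsumc, ?_, ?_⟩
  · rw [hint, ← tsum_mul_left]
    refine Summable.tsum_le_tsum (fun x => ?_) (hsumc.mul_left _) hsumβ
    by_cases h : ψ ((xi β)⁻¹ • siteW x) = 0
    · rw [h]; simp
    · calc (1 - ε) * (ψ ((xi β)⁻¹ • siteW x) * criticalTwoPoint 3 x)
          = ψ ((xi β)⁻¹ • siteW x) * ((1 - ε) * criticalTwoPoint 3 x) := by ring
        _ ≤ ψ ((xi β)⁻¹ • siteW x) * twoPointFree 3 β x :=
            mul_le_mul_of_nonneg_left (hwin x h) (hψ0 _)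
  · rw [hint]
    refine Summable.tsum_le_tsum (fun x => ?_) hsumβ hsumc
    exact mul_le_mul_of_nonneg_left (IsingInputs.G_le_critical hβ hβc.le x) (hψ0 _)

/-! ## Continuity of `ξ₂` and the choice `ξ₂(β(L)) = κ L` -/

/-- `ξ₂` is continuous on `(0, β_c)`. -/
theorem continuousAt_xi {β₀ : ℝ} (h0 : 0 < β₀) (hc : β₀ < criticalBeta 3) : ContinuousAt xi β₀ := by
  have hchi : ContinuousAt chi β₀ := by
    have h := IsingInputs.continuousAt_tsum_weight_mul_G (w := fun _ => (1 : ℝ)) (A := 0) (B := 1) (q := 0)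
      (fun x => by simp) h0 hc
    have heq : (fun β => ∑' x : Site 3, (1 : ℝ) * twoPointFree 3 β x) = chi :=
      funext fun β => tsum_congr fun x => one_mul _
    rwa [heq] at h
  have hmsq : ContinuousAt msq β₀ := by
    have h := IsingInputs.continuousAt_tsum_weight_mul_G (w := fun x : Site 3 => ∑ i, ((x i : ℤ) : ℝ) ^ 2)
      (A := 9) (B := 0) (q := 2) (fun x => by
        rw [abs_of_nonneg (Finset.sum_nonneg fun _ _ => sq_nonneg _), ← norm_siteV_sq, add_zero]
        nlinarith [norm_siteV_le x, norm_nonneg (siteV x), norm_nonneg x]) h0 hc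
    exact h
  exact ((hmsq.div hchi (chi_pos h0.le hc).ne').sqrt)

/-- **Matching the scales**: given `κ > 0` and `b < β_c`, for all large `L` there is
`β ∈ (b, β_c)` with `ξ₂(β) = κ L` (continuity of `ξ₂` on `(0, β_c)`, `ξ₂ → ∞`, and the intermediate
value theorem). -/
theorem exists_beta_matching_scale (hξ : Tendsto xi (𝓝[<] (criticalBeta 3)) atTop) {κ : ℝ}
    (hκ : 0 < κ) {b : ℝ} (hb : b < criticalBeta 3) :
    ∃ L₀ : ℝ, ∀ L : ℝ, L₀ ≤ L → ∃ β : ℝ, b < β ∧ β < criticalBeta 3 ∧ xi β = κ * L := by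
  set b' : ℝ := (max b 0 + criticalBeta 3) / 2 with hb'
  have hbc := (criticalBeta_pos_holds (d := 3) (by norm_num))
  have hb'1 : max b 0 < b' := by rw [hb']; have := max_lt hb hbc; linarith
  have hb'2 : b' < criticalBeta 3 := by rw [hb']; have := max_lt hb hbc; linarith
  have hb'0 : 0 < b' := lt_of_le_of_lt (le_max_right _ _) hb'1
  refine ⟨xi b' / κ + 1, fun L hL => ?_⟩
  have hκL : xi b' < κ * L := by
    have : xi b' / κ < L := by linarith
    rwa [div_lt_iff₀ hκ, mul_comm] at this
  -- a point `b'' ∈ (b', β_c)` with `ξ₂(b'') ≥ κ L`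
  obtain ⟨b'', hb''1, hb''2⟩ := ((tendsto_atTop.1 hξ (κ * L)).and (Ioo_mem_nhdsLT hb'2)).exists
  -- IVT on `[b', b'']`
  have hcont : ContinuousOn xi (Icc b' b'') := by
    refine continuousOn_of_forall_continuousAt fun β hβ => continuousAt_xi (hb'0.trans_le hβ.1)
      (lt_of_le_of_lt hβ.2 hb''2.2)
  obtain ⟨β, hβ, hβeq⟩ := intermediate_value_Icc hb''2.1.le hcont ⟨hκL.le, hb''1⟩
  exact ⟨β, lt_of_lt_of_le (lt_of_le_of_lt (le_max_left _ _) hb'1) hβ.1, lt_of_le_of_lt hβ.2 hb''2.2,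
    hβeq⟩

end Summit.CriticalPhenomena.Ising3DConformalLimit.Theorems.HarmonicMomentsIsotropy

end
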